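import Summits.Langlands.Langlands.Theorems.RamifiedCoefficientSeedAdjointLiftingGL3BirthDefs4
import Summits.Langlands.Langlands.Theorems.RamifiedCoefficientSeedAdjointLiftingGL3StubLocalInertialTypeCore
import Summits.Langlands.Langlands.Theorems.RamifiedCoefficientSeedAdjointLiftingGL3StubLocalInertialTypeFrames
import HarnessLib

/-!
# Crux `AdjointLiftingGL3` (stmt-Langlands-16779), line `birth`: stub `stub_localInertialType`
# (CORE-A of the Fontaine–Laffaille stub S2a)

The registered stub `stub_localInertialType` of skeleton v6 of `Cruxes/AdjointLiftingGL3/Lines/birth.lean`: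
for a non-archimedean local field `K` with `#𝓀[K] = p ≥ 11`, `V : Γ_K → GL₂(k)` and
`χ : Γ_K → GL₁(k)` with open kernels (`k = ℤ̄_p/𝔪`), and `T = χ ⊗ ad⁰ V` (`IsTwistedAdZero`), the
Fontaine–Laffaille data `FLDataAt K p T ι ϖ hϖ {0, 1, 2}` (conjunct (i): on `I_K`, `T` is
triangular with diagonal the tame inertia characters of blocks of digit multiset `{0, 1, 2}`) imply
`InertialCharEq K p χ ι ϖ hϖ` (`χ|_{I_K} = ω⁻¹`) and either `LocalShapeT K p V ι ϖ hϖ` (the tame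
cases: `ω^s ⊗ (ω ⊕ 1)` with `V` trivial on the `I_K^u`, `u > 1`, or `ω^s ⊗ (ψ₂ ⊕ ψ₂^p)`) or
`WildFrameOf K p V ι ϖ hϖ` (the wild case: a `Γ_K`-triangular frame of inertial diagonal
`(ω^{s+e}, ω^s)`, `e = ±1`, consumed by the other half `stub_localShapeWild`).

Proof (files `…StubLocalInertialTypeArith/Core/Frames.lean`): `χ|_{I_K} = ω^c`
(`exists_det_eq_fundamentalCharacter_pow`); in Serre's frame of `V` (`exists_tame_frame`,
`exists_wild_frame`) the root multiset of `charpoly T(σ)`, `σ ∈ I_K`, is both the multiset of block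
characters at `σ` and `{x, x α/β, x β/α}` (`univ_val_map_eq_of_isTwistedAdZero`); the exponent
arithmetic `localInertialType_core` at `σ₂` with `ψ₂(σ₂)` of order `p² − 1` gives `(p − 1) ∣ c + 1`
and the congruence on `α/β`, which `levelOne_dvd` / `levelTwo_dvd` turn into `b₀ − b₁ ≡ ±1 (mod p−1)`
(level one) or `n ≡ ±1 (mod p+1)` (level two); §1 (`levelTwo_localShape`) and the swap of the basis
vectors give the normalised shapes.

References: Fontaine–Laffaille 1982 Thm. 5.3 (iii); Gee–Herzig–Liu–Savitt 2017 Prop. 2.3.1;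
Serre 1987 §2.1 Prop. 1, §2.2–2.4; Serre 1972 §1.7.
-/

set_option linter.dupNamespace false -- `Summit.Langlands.Langlands` is the mandated namespace

noncomputable section

namespace Summit.Langlands.Langlands.Cruxes.AdjointLiftingGL3.Birth

open scoped MatrixGroups
open Field ValuativeRel
open Literature.NumberTheory.GaloisRepresentations
open Literature.NumberTheory.GaloisRepresentations.IsNonarchimedeanLocalField
open Literature.NumberTheory.GaloisRepresentations.ModPGaloisRep.InertiaShape

/-! ## §1. Level two: `diag(ψ₂^n, ψ₂^{qn}) = ω^s · diag(ψ₂, ψ₂^q)` when `(q + 1) ∣ n − 1` -/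

section LevelTwo

variable {K : Type} [Field K] [ValuativeRel K] [TopologicalSpace K] [IsNonarchimedeanLocalField K]
variable {k : Type*} [Field k]

/-- `x ^ n = 1` and `n ∣ A − B` give `x ^ A = x ^ B` (integer exponents). [folklore] -/
theorem zpow_eq_zpow_of_pow_eq_one {G : Type*} [Group G] {x : G} {n : ℕ} (hx : x ^ n = 1) {A B : ℤ}
    (h : (n : ℤ) ∣ A - B) : x ^ A = x ^ B :=
  orderOf_dvd_sub_iff_zpow_eq_zpow.mp ((Int.natCast_dvd_natCast.mpr (orderOf_dvd_of_pow_eq_one hx)).trans h)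

/-- `ω = ψ₂^{q+1}` (the accepted `fundamentalCharacter_pow_holds` at `m = 2`, with
`(q² − 1)/(q − 1) = q + 1`). [cite: SerreInventiones1972, §1.7, eq. (10)] -/
theorem fundamentalCharacter_two_pow_succ (ι : absIntegers 𝒪[K] K ⧸ absMaximalIdeal K →+* k)
    (ϖ : 𝒪[K]) (hϖ : Irreducible ϖ) :
    fundamentalCharacter K 2 ι ϖ hϖ ^ (residueFieldCard K + 1) = fundamentalCharacter K 1 ι ϖ hϖ := by
  have hq1 : 1 ≤ residueFieldCard K := (one_lt_residueFieldCard K).le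
  have h := fundamentalCharacter_pow_holds K 2 two_ne_zero ι ϖ hϖ
  have e : (residueFieldCard K ^ 2 - 1) / (residueFieldCard K - 1) = residueFieldCard K + 1 := by
    have : residueFieldCard K ^ 2 - 1 = (residueFieldCard K - 1) * (residueFieldCard K + 1) := by
      zify [Nat.one_le_pow 2 _ hq1, hq1]; ring
    rw [this, Nat.mul_div_cancel_left _ (by have := one_lt_residueFieldCard K; omega)]
  rwa [e] at h

/-- **The level-two shape from the congruence `n ≡ 1 (mod q + 1)`.**  If `P V(σ) P⁻¹ =
diag(ψ₂(σ)^n, ψ₂(σ)^{qn})` on `I_K` and `(q + 1) ∣ n − 1`, then for `s ≡ (n − 1)/(q + 1)` modulo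
`q − 1`: `P V(σ) P⁻¹ = ω(σ)^s · diag(ψ₂(σ), ψ₂(σ)^q)` (`ω = ψ₂^{q+1}`, `ψ₂^{q²−1} = 1`).
[cite: Serre1987, §2.2 (2.2.1)] -/
theorem levelTwo_localShape {V : absoluteGaloisGroup K →* GL (Fin 2) k}
    (ι : absIntegers 𝒪[K] K ⧸ absMaximalIdeal K →+* k) (ϖ : 𝒪[K]) (hϖ : Irreducible ϖ)
    {P : GL (Fin 2) k} {n : ℕ}
    (hdiag : ∀ σ : absInertia K,
      ((P * V (σ : absoluteGaloisGroup K) * P⁻¹ : GL (Fin 2) k) : Matrix (Fin 2) (Fin 2) k) =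
        !![((fundamentalCharacter K 2 ι ϖ hϖ σ ^ n : kˣ) : k), 0;
          0, ((fundamentalCharacter K 2 ι ϖ hϖ σ ^ (residueFieldCard K * n) : kˣ) : k)])
    (hn : ((residueFieldCard K : ℤ) + 1) ∣ (n : ℤ) - 1) :
    ∃ s : ℕ, ∀ σ : absInertia K,
      ((P * V (σ : absoluteGaloisGroup K) * P⁻¹ : GL (Fin 2) k) : Matrix (Fin 2) (Fin 2) k) =
        (((fundamentalCharacter K 1 ι ϖ hϖ σ) ^ s : kˣ) : k) •
          !![(((fundamentalCharacter K 2 ι ϖ hϖ σ) : kˣ) : k), 0;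
            0, (((fundamentalCharacter K 2 ι ϖ hϖ σ) ^ residueFieldCard K : kˣ) : k)] := by
  set q := residueFieldCard K with hqdef
  have hq2 : 2 ≤ q := one_lt_residueFieldCard K
  obtain ⟨t, ht⟩ := hn
  set m : ℕ := q - 1 with hmdef
  have hm : (m : ℤ) = q - 1 := by rw [hmdef, Nat.cast_sub (by omega)]; simp
  have hm0 : (m : ℤ) ≠ 0 := by rw [hm]; omega
  set s : ℕ := Int.toNat (t % m) with hsdef
  have hs : (s : ℤ) = t % m := Int.toNat_of_nonneg (Int.emod_nonneg _ hm0)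
  have hst : (m : ℤ) ∣ t - s := ⟨t / m, by rw [hs, Int.emod_def]; ring⟩
  have hQ : ((q ^ 2 - 1 : ℕ) : ℤ) = ((q : ℤ) + 1) * m := by
    rw [Nat.cast_sub (Nat.one_le_pow _ _ (by omega)), hm]; push_cast; ring
  refine ⟨s, fun σ => ?_⟩
  set z := fundamentalCharacter K 2 ι ϖ hϖ σ with hz
  have hzQ : z ^ (q ^ 2 - 1) = 1 := by
    rw [hz, ← MonoidHom.pow_apply, fundamentalCharacter_pow_eq_one two_ne_zero, MonoidHom.one_apply]
  have hω : fundamentalCharacter K 1 ι ϖ hϖ σ = z ^ (q + 1) := by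
    rw [← fundamentalCharacter_two_pow_succ ι ϖ hϖ, MonoidHom.pow_apply]
  have h00 : z ^ n = (z ^ (q + 1)) ^ s * z := by
    have h := zpow_eq_zpow_of_pow_eq_one hzQ (A := n) (B := (((q + 1) * s + 1 : ℕ) : ℤ))
      (by
        rw [hQ]; push_cast
        obtain ⟨u, hu⟩ := hst
        exact ⟨u, by linear_combination ht + ((q : ℤ) + 1) * hu⟩)
    rw [zpow_natCast, zpow_natCast] at h
    rw [h, pow_succ, pow_mul]
  have h11 : z ^ (q * n) = (z ^ (q + 1)) ^ s * z ^ q := by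
    have h := zpow_eq_zpow_of_pow_eq_one hzQ (A := ((q * n : ℕ) : ℤ)) (B := (((q + 1) * s + q : ℕ) : ℤ))
      (by
        rw [hQ]; push_cast
        obtain ⟨u, hu⟩ := hst
        exact ⟨t + u, by linear_combination (q : ℤ) * ht + ((q : ℤ) + 1) * hu - ((q : ℤ) + 1) * t * hm⟩)
    rw [zpow_natCast, zpow_natCast] at h
    rw [h, pow_add, pow_mul]
  rw [hdiag σ, ← hz, hω, h00, h11]
  ext i j
  fin_cases i <;> fin_cases j <;> simp

end LevelTwo

/-! ## §2. The registered stub -/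

section Main

open scoped NumberField
open NumberField IsDedekindDomain Filter Literature.NumberTheory.PAdicHodge

/-- **CORE-A of stub S2a (`stub_localInertialType`).**  For a `p`-adic field `K` with `#𝓀[K] = p ≥ 11`,
`V : Γ_K → GL₂(k)`, `χ : Γ_K → GL₁(k)` with open kernels (`k = ℤ̄_p/𝔪`) and `T = χ ⊗ ad⁰ V`
(`IsTwistedAdZero`), conjunct (i) of the Fontaine–Laffaille data `FLDataAt K p T ι ϖ hϖ {0,1,2}`
forces `χ|_{I_K} = ω⁻¹` (`InertialCharEq`) and either the local shape (T) of `V` (tame cases: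
`ω^s ⊗ (ω ⊕ 1)` or `ω^s ⊗ (ψ₂ ⊕ ψ₂^p)` on `I_K`) or a wild frame (`V` not tame, triangular on `Γ_K`
with inertial diagonal `(ω^{s+e}, ω^s)`, `e = ±1`).  Proof: on `I_K`, `charpoly T(σ)` has root
multiset the Fontaine–Laffaille block characters (conjunct (i)) and also `{x, xα/β, xβ/α}`
(`x = χ(σ) = ω^c`, `(α, β)` the inertial diagonal of `V` in Serre's frame); the exponent arithmetic
at `σ₂` (`ψ₂(σ₂)` of order `p² − 1`) and `σ₃` is `localInertialType_core`.
[cite: FontaineLaffaille1982, Thm. 5.3 (iii)] [cite: Serre1987, §2.1 Prop. 1, §2.2–2.4]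
[cite: GeeHerzigLiuSavitt2017, Prop. 2.3.1] -/
theorem stub_localInertialType :
    ∀ (p : ℕ) [Fact p.Prime], 11 ≤ p →
      ∀ (K : Type) [Field K] [ValuativeRel K] [TopologicalSpace K] [IsNonarchimedeanLocalField K],
        residueFieldCard K = p →
        ∀ (V : absoluteGaloisGroup K →* GL (Fin 2) (padicAlgClResidueField p))
          (χ : absoluteGaloisGroup K →* GL (Fin 1) (padicAlgClResidueField p))
          (T : absoluteGaloisGroup K →* GL (Fin 3) (padicAlgClResidueField p)),
          IsOpen (V.ker : Set (absoluteGaloisGroup K)) → IsOpen (χ.ker : Set (absoluteGaloisGroup K)) →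
          IsTwistedAdZero T V χ →
          ∀ (ι : absIntegers (↥(ValuativeRel.valuation K).integer) K ⧸ absMaximalIdeal K →+*
                padicAlgClResidueField p)
            (ϖ : ↥(ValuativeRel.valuation K).integer) (hϖ : Irreducible ϖ),
            FLDataAt K p T ι ϖ hϖ {0, 1, 2} →
              InertialCharEq K p χ ι ϖ hϖ ∧ (LocalShapeT K p V ι ϖ hϖ ∨ WildFrameOf K p V ι ϖ hϖ) := by
  intro p _ hp K _ _ _ _ hKp V χ T hV hχ hTw ι ϖ hϖ hFL
  classical
  -- the discrete coefficient field
  set k := padicAlgClResidueField p with hk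
  letI : TopologicalSpace k := ⊥
  haveI : DiscreteTopology k := ⟨rfl⟩
  have hq : 11 ≤ residueFieldCard K := by rw [hKp]; exact hp
  have hq' : (11 : ℤ) ≤ residueFieldCard K := by exact_mod_cast hq
  have hωq : ∀ σ : absInertia K, fundamentalCharacter K 1 ι ϖ hϖ σ ^ (residueFieldCard K - 1) = 1 :=
    fun σ => by
    rw [← MonoidHom.pow_apply, fundamentalCharacter_one_pow_eq_one, MonoidHom.one_apply]
  have hm : ((residueFieldCard K - 1 : ℕ) : ℤ) = (residueFieldCard K : ℤ) - 1 := by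
    rw [Nat.cast_sub (by omega)]; simp
  -- continuity of `V`, `χ`
  set Vc : ModPGaloisRep K k 2 :=
    ⟨V, Literature.NumberTheory.Automorphic.MonoidHom.continuous_of_isOpen_ker V hV⟩ with hVc
  set χc : ModPGaloisRep K k 1 :=
    ⟨χ, Literature.NumberTheory.Automorphic.MonoidHom.continuous_of_isOpen_ker χ hχ⟩ with hχc
  have hVc_apply : ∀ g, Vc g = V g := fun _ => rfl
  -- `χ = ω^c` on `I_K`
  obtain ⟨c, hc⟩ := exists_det_eq_fundamentalCharacter_pow χc ι ϖ hϖ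
  have hx : ∀ σ : absInertia K,
      ((χ (σ : absoluteGaloisGroup K) : GL (Fin 1) k) : Matrix (Fin 1) (Fin 1) k) 0 0 =
        ((fundamentalCharacter K 1 ι ϖ hϖ σ ^ c : kˣ) : k) := fun σ => by
    rw [← hc σ, Matrix.GeneralLinearGroup.val_det_apply, Matrix.det_fin_one]; rfl
  have hE : ((residueFieldCard K : ℤ) - 1 ∣ (c : ℤ) + 1) → InertialCharEq K p χ ι ϖ hϖ := by
    intro h1 σ
    rw [hx σ]
    have h := zpow_eq_zpow_of_pow_eq_one (hωq σ) (A := c) (B := -1)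
      (by rw [hm, sub_neg_eq_add]; exact h1)
    rw [zpow_natCast, zpow_neg, zpow_one] at h
    rw [h]
  -- the Fontaine–Laffaille blocks and the root multiset identity (in `kˣ`)
  obtain ⟨⟨B, PT, dI, hdig, hchar, hT⟩, -⟩ := hFL
  have hC2 : ∀ (σ : absInertia K) (P₂ : GL (Fin 2) k) (α β : kˣ),
      ((P₂ * V (σ : absoluteGaloisGroup K) * P₂⁻¹ : GL (Fin 2) k) : Matrix (Fin 2) (Fin 2) k) 1 0 = 0 →
      ((P₂ * V (σ : absoluteGaloisGroup K) * P₂⁻¹ : GL (Fin 2) k) : Matrix (Fin 2) (Fin 2) k) 0 0 = α →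
      ((P₂ * V (σ : absoluteGaloisGroup K) * P₂⁻¹ : GL (Fin 2) k) : Matrix (Fin 2) (Fin 2) k) 1 1 = β →
      (flBlockCharacters K ι ϖ hϖ B).map (fun δ => δ σ) =
        {fundamentalCharacter K 1 ι ϖ hϖ σ ^ c, fundamentalCharacter K 1 ι ϖ hϖ σ ^ c * (α / β),
          fundamentalCharacter K 1 ι ϖ hϖ σ ^ c * (α / β)⁻¹} := by
    intro σ P₂ α β h10 hα hβ
    have h := univ_val_map_eq_of_isTwistedAdZero hTw (σ : absoluteGaloisGroup K)
      (PT := PT) (d := fun i => ((dI i σ : kˣ) : k))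
      (fun i j hij => (hT σ i j).1 hij) (fun i => (hT σ i i).2) h10
    rw [hx σ, hα, hβ] at h
    refine Multiset.map_injective Units.val_injective ?_
    rw [← hchar, Multiset.map_map, Multiset.map_map,
      show ((Units.val ∘ fun δ : ↥(absInertia K) →* kˣ => δ σ) ∘ dI) =
        fun i => ((dI i σ : kˣ) : k) from rfl, h]
    simp only [Multiset.insert_eq_cons, Multiset.map_cons, Multiset.map_singleton, Units.val_mul,
      Units.val_div_eq_div_val, inv_div, mul_div_assoc]
  -- `σ₂` with `ψ₂(σ₂)` of exact order `q² - 1`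
  obtain ⟨σ₂, hζ⟩ := exists_isPrimitiveRoot_fundamentalCharacter two_ne_zero ι ϖ hϖ
  rw [IsPrimitiveRoot.coe_units_iff] at hζ
  have hw : fundamentalCharacter K 1 ι ϖ hϖ σ₂ =
      fundamentalCharacter K 2 ι ϖ hϖ σ₂ ^ (residueFieldCard K + 1) := by
    rw [← fundamentalCharacter_two_pow_succ ι ϖ hϖ, MonoidHom.pow_apply]
  have hNf : (residueFieldCard K : ℤ) ^ 2 - 1 =
      ((residueFieldCard K : ℤ) + 1) * ((residueFieldCard K : ℤ) - 1) := by ring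
  -- the arithmetic core, for any inertial frame of `V`
  have key : ∀ (P₂ : GL (Fin 2) k) (α β : absInertia K → kˣ),
      (∀ σ : absInertia K,
        ((P₂ * V (σ : absoluteGaloisGroup K) * P₂⁻¹ : GL (Fin 2) k) : Matrix (Fin 2) (Fin 2) k) 1 0 = 0) →
      (∀ σ : absInertia K,
        ((P₂ * V (σ : absoluteGaloisGroup K) * P₂⁻¹ : GL (Fin 2) k) : Matrix (Fin 2) (Fin 2) k) 0 0 =
          α σ) →
      (∀ σ : absInertia K,
        ((P₂ * V (σ : absoluteGaloisGroup K) * P₂⁻¹ : GL (Fin 2) k) : Matrix (Fin 2) (Fin 2) k) 1 1 =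
          β σ) →
      ∀ L : ℤ, α σ₂ / β σ₂ = fundamentalCharacter K 2 ι ϖ hϖ σ₂ ^ L →
        ((residueFieldCard K : ℤ) - 1 ∣ (c : ℤ) + 1) ∧
          (((residueFieldCard K : ℤ) + 1) * ((residueFieldCard K : ℤ) - 1) ∣
              L - ((residueFieldCard K : ℤ) + 1) ∨
            ((residueFieldCard K : ℤ) + 1) * ((residueFieldCard K : ℤ) - 1) ∣
              L + ((residueFieldCard K : ℤ) + 1) ∨
            ((residueFieldCard K : ℤ) + 1) * ((residueFieldCard K : ℤ) - 1) ∣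
              L - ((residueFieldCard K : ℤ) - 1) ∨
            ((residueFieldCard K : ℤ) + 1) * ((residueFieldCard K : ℤ) - 1) ∣
              L + ((residueFieldCard K : ℤ) - 1)) := by
    intro P₂ α β h10 hα hβ L hL
    have hC2u : ∀ σ : absInertia K, (flBlockCharacters K ι ϖ hϖ B).map (fun δ => δ σ) =
        {fundamentalCharacter K 1 ι ϖ hϖ σ ^ c, fundamentalCharacter K 1 ι ϖ hϖ σ ^ c * (α σ / β σ),
          fundamentalCharacter K 1 ι ϖ hϖ σ ^ c * (α σ / β σ)⁻¹} := fun σ =>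
      hC2 σ P₂ (α σ) (β σ) (h10 σ) (hα σ) (hβ σ)
    have h := localInertialType_core K k hq ι ϖ hϖ B hdig c
      (fun σ => fundamentalCharacter K 1 ι ϖ hϖ σ ^ c) (fun _ => rfl)
      (fun σ => by rw [hC2u σ]; exact Multiset.mem_cons_self _ _) σ₂ hζ L (by rw [hC2u σ₂, hL])
    rwa [hNf] at h
  -- Serre's frames
  by_cases ht : Vc.IsTamelyRamified
  · obtain ⟨P, hlev⟩ := exists_tame_frame Vc ι ϖ hϖ ht
    simp only [hVc_apply] at hlev
    have hwild1 : ∀ u : ℝ, 1 < u → ∀ σ ∈ absUpperInertia K u, V σ = 1 := fun u hu σ hσ =>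
      ht u (by linarith) σ hσ
    rcases hlev with ⟨b₀, b₁, hdiag⟩ | ⟨n, hdiag⟩
    · ---------------------------------------------------------------- tame, level one
      obtain ⟨hc1, hL⟩ := key P (fun σ => fundamentalCharacter K 1 ι ϖ hϖ σ ^ b₀)
        (fun σ => fundamentalCharacter K 1 ι ϖ hϖ σ ^ b₁)
        (fun σ => by rw [hdiag σ]; simp) (fun σ => by rw [hdiag σ]; simp)
        (fun σ => by rw [hdiag σ]; simp)
        (((residueFieldCard K : ℤ) + 1) * ((b₀ : ℤ) - b₁))
        (by
          rw [hw, ← pow_mul, ← pow_mul, div_eq_mul_inv, ← zpow_natCast, ← zpow_natCast, ← zpow_sub]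
          congr 1; push_cast; ring)
      refine ⟨hE hc1, Or.inl ?_⟩
      rcases levelOne_dvd hq' hL with h | h
      · refine ⟨b₁, Or.inl ⟨P, fun σ => ⟨0, ?_⟩, hwild1⟩⟩
        have e : fundamentalCharacter K 1 ι ϖ hϖ σ ^ b₀ =
            fundamentalCharacter K 1 ι ϖ hϖ σ ^ b₁ * fundamentalCharacter K 1 ι ϖ hϖ σ := by
          have h' := zpow_eq_zpow_of_pow_eq_one (hωq σ) (A := b₀) (B := ((b₁ + 1 : ℕ) : ℤ))
            (by rw [hm]; push_cast; rwa [show (b₀ : ℤ) - b₁ - 1 = b₀ - (b₁ + 1) by ring] at h)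
          rw [zpow_natCast, zpow_natCast] at h'
          rw [h', pow_succ]
        rw [hdiag σ, e]
        ext i j
        fin_cases i <;> fin_cases j <;> simp
      · refine ⟨b₀, Or.inl ⟨swapGL * P, fun σ => ⟨0, ?_⟩, hwild1⟩⟩
        have e : fundamentalCharacter K 1 ι ϖ hϖ σ ^ b₁ =
            fundamentalCharacter K 1 ι ϖ hϖ σ ^ b₀ * fundamentalCharacter K 1 ι ϖ hϖ σ := by
          have h' := zpow_eq_zpow_of_pow_eq_one (hωq σ) (A := b₁) (B := ((b₀ + 1 : ℕ) : ℤ))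
            (by
              rw [hm]; push_cast
              have h' := dvd_neg.mpr h
              rwa [show -((b₀ : ℤ) - b₁ + 1) = b₁ - (b₀ + 1) by ring] at h')
          rw [zpow_natCast, zpow_natCast] at h'
          rw [h', pow_succ]
        rw [mul_inv_rev,
          show swapGL * P * V (σ : absoluteGaloisGroup K) * (P⁻¹ * swapGL⁻¹) =
            swapGL * (P * V (σ : absoluteGaloisGroup K) * P⁻¹) * swapGL⁻¹ by
              simp only [mul_assoc],
          Units.val_mul, Units.val_mul, hdiag σ, swapGL_conj_diag, e]
        ext i j
        fin_cases i <;> fin_cases j <;> simp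
    · ---------------------------------------------------------------- tame, level two
      have hψQ : ∀ σ : absInertia K,
          fundamentalCharacter K 2 ι ϖ hϖ σ ^ (residueFieldCard K ^ 2 - 1) = 1 := fun σ => by
        rw [← MonoidHom.pow_apply, fundamentalCharacter_pow_eq_one two_ne_zero, MonoidHom.one_apply]
      have hQ : ((residueFieldCard K ^ 2 - 1 : ℕ) : ℤ) =
          ((residueFieldCard K : ℤ) + 1) * ((residueFieldCard K : ℤ) - 1) := by
        rw [Nat.cast_sub (Nat.one_le_pow _ _ (by omega))]; push_cast; ring
      obtain ⟨hc1, hL⟩ := key P (fun σ => fundamentalCharacter K 2 ι ϖ hϖ σ ^ n)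
        (fun σ => fundamentalCharacter K 2 ι ϖ hϖ σ ^ (residueFieldCard K * n))
        (fun σ => by rw [hdiag σ]; simp) (fun σ => by rw [hdiag σ]; simp)
        (fun σ => by rw [hdiag σ]; simp) ((n : ℤ) * (1 - residueFieldCard K))
        (by
          rw [div_eq_mul_inv, ← zpow_natCast, ← zpow_natCast, ← zpow_sub]
          congr 1; push_cast; ring)
      refine ⟨hE hc1, Or.inl ?_⟩
      rcases levelTwo_dvd hq' hL with h | h
      · obtain ⟨s, hs⟩ := levelTwo_localShape (V := V) ι ϖ hϖ (P := P) (n := n) hdiag h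
        refine ⟨s, Or.inr ⟨P, fun σ => ?_⟩⟩
        have h' := hs σ
        rw [hKp] at h'
        exact h'
      · -- swap the basis: exponents `(qn, n) = (n', q n')` with `n' = q n`, `(q + 1) ∣ n' - 1`
        have hdiag' : ∀ σ : absInertia K,
            ((swapGL * P * V (σ : absoluteGaloisGroup K) * (swapGL * P)⁻¹ : GL (Fin 2) k) :
              Matrix (Fin 2) (Fin 2) k) =
              !![((fundamentalCharacter K 2 ι ϖ hϖ σ ^ (residueFieldCard K * n) : kˣ) : k), 0;
                0, ((fundamentalCharacter K 2 ι ϖ hϖ σ ^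
                  (residueFieldCard K * (residueFieldCard K * n)) : kˣ) : k)] := by
          intro σ
          have e : fundamentalCharacter K 2 ι ϖ hϖ σ ^ n =
              fundamentalCharacter K 2 ι ϖ hϖ σ ^ (residueFieldCard K * (residueFieldCard K * n)) := by
            have h' := zpow_eq_zpow_of_pow_eq_one (hψQ σ) (A := n)
              (B := ((residueFieldCard K * (residueFieldCard K * n) : ℕ) : ℤ))
              (by rw [hQ]; push_cast; exact ⟨-(n : ℤ), by ring⟩)
            rwa [zpow_natCast, zpow_natCast] at h'
          rw [mul_inv_rev,
            show swapGL * P * V (σ : absoluteGaloisGroup K) * (P⁻¹ * swapGL⁻¹) =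
              swapGL * (P * V (σ : absoluteGaloisGroup K) * P⁻¹) * swapGL⁻¹ by
                simp only [mul_assoc],
            Units.val_mul, Units.val_mul, hdiag σ, swapGL_conj_diag, ← e]
        obtain ⟨s, hs⟩ := levelTwo_localShape (V := V) ι ϖ hϖ (P := swapGL * P)
          (n := residueFieldCard K * n) hdiag'
          (by
            obtain ⟨t, ht'⟩ := h
            push_cast
            exact ⟨(residueFieldCard K : ℤ) * t - 1, by linear_combination (residueFieldCard K : ℤ) * ht'⟩)
        refine ⟨s, Or.inr ⟨swapGL * P, fun σ => ?_⟩⟩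
        have h' := hs σ
        rw [hKp] at h'
        exact h'
  · ---------------------------------------------------------------- wild
    obtain ⟨P, b₀, b₁, hP, hd⟩ := exists_wild_frame Vc ι ϖ hϖ ht
    simp only [hVc_apply] at hP hd
    obtain ⟨hc1, hL⟩ := key P (fun σ => fundamentalCharacter K 1 ι ϖ hϖ σ ^ b₀)
      (fun σ => fundamentalCharacter K 1 ι ϖ hϖ σ ^ b₁)
      (fun σ => hP σ) (fun σ => (hd σ).1) (fun σ => (hd σ).2)
      (((residueFieldCard K : ℤ) + 1) * ((b₀ : ℤ) - b₁))
      (by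
        rw [hw, ← pow_mul, ← pow_mul, div_eq_mul_inv, ← zpow_natCast, ← zpow_natCast, ← zpow_sub]
        congr 1; push_cast; ring)
    refine ⟨hE hc1, Or.inr ⟨?_, ?_⟩⟩
    · by_contra hcon
      push Not at hcon
      exact ht fun v hv σ hσ => hcon v hv σ hσ
    -- the exponent `e = ±1`
    obtain ⟨e, he, hediv⟩ : ∃ e : ℤ, (e = 1 ∨ e = -1) ∧
        ((residueFieldCard K : ℤ) - 1 ∣ (b₀ : ℤ) - b₁ - e) := by
      rcases levelOne_dvd hq' hL with h | h
      · exact ⟨1, Or.inl rfl, h⟩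
      · exact ⟨-1, Or.inr rfl, by rw [sub_neg_eq_add]; exact h⟩
    refine ⟨P, b₁, e, he, hP, fun σ => ⟨(hd σ).2, ?_⟩⟩
    rw [(hd σ).1, MonoidHom.zpow_apply, ← Units.val_mul]
    congr 1
    have h' := zpow_eq_zpow_of_pow_eq_one (hωq σ) (A := b₀) (B := (b₁ : ℤ) + e)
      (by rw [hm]; rwa [show (b₀ : ℤ) - b₁ - e = b₀ - (b₁ + e) by ring] at hediv)
    rw [zpow_natCast, zpow_add, zpow_natCast] at h'
    exact h'

end Main

end Summit.Langlands.Langlands.Cruxes.AdjointLiftingGL3.Birth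

end
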